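import Summits.HodgeConjecture.HodgeConjecture.Theorems.K2E3KeysThmTwoDepthZeroBranchBConstants   -- ★ p32: the frame + ★ PairConstants `integral_toFun_conj_eq`, ★ `theta_conj_eq_one`, ★ `measurableSet_setOf_conj_mem` (all place-generic)
import Summits.HodgeConjecture.HodgeConjecture.Theorems.R90S1BranchBHaarFactsNRamified            -- ★∕📤 (this seat) `measureReal_setOf_conj_mem_eq_ram` (`vol N(𝔭) = q⁻¹ vol N₀`); brings ★ `unitModulusChar_eq_inv_absNorm_of_valued_eq`
import Mathlib.NumberTheory.NumberField.Completion.FinitePlace                                    -- `NumberField.HeightOneSpectrum.one_lt_absNorm`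
import HarnessLib

/-!
# R90 · S1 ∕ U4Keys leaf (U4f-χ₁-ram-one-d0B) — the two RAMIFIED constant letters of the end assembly on `U(Φ₃)(L⁺_v)`: `|X| = |χ₁(σΠ·Π)| < 1` and `Λ_{w₀} f₁ = q⁻¹·μ(N₀)`
# [Keys1984 §7 Thm (2) (d); Casselman1980 §3; PAPER-Z3-DepthZeroRamified §0–§1 (R90-C10-p05 (g0), r01-screened)]

Cell `hodgecm-mathlib`, SLAB R90-TF, section S1 «Ch. 12 local», crux H413 = `stmt-HodgeConjecture-24833` (lane `--supports … --as helper`), route HCCMUnconditional; prover seat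
`hodgecm-mathlib-R90-C10-p05` (g0); socket of record S1#3′ = K2E3 leaf (U4f-χ₁-ram-one) ⊇ U4Keys :155 (depth 0, Branch B).  THEOREMS ONLY (no definition ∕ instance ∕ notation ∕
named fact ∕ `sorry`); ★-only imports.  The RAMIFIED twins of the two `hunr`-dependent items of ★ `K2E3KeysThmTwoDepthZeroBranchBConstants` (§1 `norm_apply_uniformizer_lt_one`, §4
`integral_weyl_weyl_eq`); its §2 (`μ(N₀) ≠ 0`) and §3 (`Λ_1 f_w = μ(N₀)`, integrabilities) are place-generic ★ and reused as they stand.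

* §1 **`norm_apply_norm_uniformizer_lt_one`** — for a CONTRACTING `χ₁` and a uniformiser unit `Π` of `E_v` at ANY non-split place: `|χ₁(σΠ·Π)| < 1` (`‖σΠ·Π‖ = (N𝔓_w)⁻² < 1`,
  ★ `unitModulusChar_eq_inv_absNorm_of_valued_eq`, ★ `valued_conjLocal_apply_of_smul_eq`) — the letter `hX` of ★ `R90S1BranchBEndAssemblyRamified.exists_eta_of_det_eq_zero_of_pairEntries_ram`.
* §2 **`integral_weyl_weyl_eq_ram`** — `Λ_{w₀} f₁ = ∫_N f₁(w₀ n w₀) dμ = q⁻¹ · μ(N₀)` (`q = N𝔭_v`) at a non-split RAMIFIED place with `|2|_w = 1`, for the normalised `(I, χ̃)`-type vector `f₁`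
  (`f₁(1) = 1`, `f₁(w₀) = 0`) of `i(χ₁, 1)` and a Haar `μ` on `N(L⁺_v)` — ★ `integral_toFun_conj_eq` (place-generic) + ★∕📤 `measureReal_setOf_conj_mem_eq_ram`; the letter `h1wv`
  (with `V := μ.real N₀`; at a ramified place `N𝔓_w = N𝔭_v`).
HONEST LABEL: HC_CM is proved only modulo the 7 printed citations (2 remaining named inputs: hLiu418 = `stmt-HodgeConjecture-24832`, h413 = `stmt-HodgeConjecture-24833`) until rung 0
closes; count-neutral — the ramified d0B chain still lacks Z2-B-ram (type basis at `e = 2`), «det M = 0 from the type vector», and the two shell pieces (Z3-c-ram).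

## References
* [Keys1984] D. Keys, *Principal series representations of special unitary groups over local fields*, Compositio Math. 51 (1984), §7 Theorem (2) (d) p. 126.
* [Casselman1980] W. Casselman, *The unramified principal series of p-adic groups I*, Compositio Math. 40 (1980), §3.
* [Rogawski1990] J. D. Rogawski, *Automorphic Representations of Unitary Groups in Three Variables*, Ann. of Math. Stud. 123 (1990), §4.9 p. 54; §12.2 p. 173.
-/

set_option autoImplicit false
-- the mandated namespace has the single-problem summit's repeated segment (`HodgeConjecture.HodgeConjecture`)
set_option linter.dupNamespace false

noncomputable section

open NumberField IsDedekindDomain MeasureTheory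
open scoped Matrix MatrixGroups WithZero Valued NNReal
open Literature.NumberTheory Literature.NumberTheory.Automorphic Literature.NumberTheory.Automorphic.UnitaryGroup
open Literature.NumberTheory.Rogawski1990

namespace Summit.HodgeConjecture.HodgeConjecture.R90.S1

open Summit.HodgeConjecture.HodgeConjecture.Cruxes.H413
open Summit.HodgeConjecture.HodgeConjecture.Cruxes.H413.K2E3DepthZeroIwahoriCharacterCM
open Summit.HodgeConjecture.HodgeConjecture.Cruxes.H413.K2E3BranchATorusWitnessCM
open Summit.HodgeConjecture.HodgeConjecture.Cruxes.H413.K2E3BranchATypeLettersCM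

/-! ## §1 `|X| = |χ₁(σΠ·Π)| < 1` (contraction; any non-split place) -/

section Norm

variable (L : Type) [Field L] [NumberField L] [IsCMField L] (v : HeightOneSpectrum (𝓞 ↥(maximalRealSubfield L)))
  (hns : ∀ w : PlacesOver L v, IsCMField.complexConj L • w.1 = w.1) (w : PlacesOver L v) (hw : IsCMField.complexConj L • w.1 = w.1)

include hns hw in
/-- **`|χ₁(σΠ·Π)| < 1`** for a CONTRACTING `χ₁` (`‖x‖ < 1 ⟹ |χ₁ x| < 1`) and a uniformiser unit `Π` of `E_v` (`|Π_{w′}| = exp(−1)`): `‖σΠ·Π‖ = (N𝔓_w)⁻² < 1` (★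
`unitModulusChar_eq_inv_absNorm_of_valued_eq`, `1 < N𝔓_w`).  The letter `hX` of the ramified end assembly. [cite: Keys1984, §7 Theorem (2) (d) p. 126] [cite: Rogawski1990, §12.2 p. 173] -/
theorem norm_apply_norm_uniformizer_lt_one (piU : (LocalRing L v)ˣ) (hpiU : ∀ w' : PlacesOver L v, Valued.v ((piU : LocalRing L v) w') = WithZero.exp (-1 : ℤ))
    (χ₁ : (LocalRing L v)ˣ →* ℂˣ) (hcontr : ∀ x : (LocalRing L v)ˣ, unitModulusChar (LocalRing L v) x < 1 → ‖((χ₁ x : ℂˣ) : ℂ)‖ < 1) :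
    ‖((χ₁ (Units.map (conjLocal L (IsCMField.complexConj L) v : LocalRing L v →* LocalRing L v) piU * piU) : ℂˣ) : ℂ)‖ < 1 := by
  refine hcontr _ ?_
  have hσ : Valued.v (((Units.map (conjLocal L (IsCMField.complexConj L) v : LocalRing L v →* LocalRing L v) piU : (LocalRing L v)ˣ) : LocalRing L v) w) =
      WithZero.exp (-1 : ℤ) := by
    rw [Units.coe_map, MonoidHom.coe_coe, valued_conjLocal_apply_of_smul_eq L v w (hns w) (piU : LocalRing L v)]
    exact hpiU w
  rw [map_mul, unitModulusChar_eq_inv_absNorm_of_valued_eq L v w hw _ hσ, unitModulusChar_eq_inv_absNorm_of_valued_eq L v w hw piU (hpiU w)]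
  have hq : (1 : ℝ≥0) < (Ideal.absNorm w.1.asIdeal : ℝ≥0) := by exact_mod_cast NumberField.HeightOneSpectrum.one_lt_absNorm w.1
  rw [← mul_inv]
  exact inv_lt_one_of_one_lt₀ (one_lt_mul'' hq hq)

end Norm

/-! ## §2 `Λ_{w₀} f₁ = q⁻¹·μ(N₀)` at a ramified place, on `U(Φ₃)(L⁺_v)` -/

section Frame

variable (L : Type) [Field L] [NumberField L] [IsCMField L] (v : HeightOneSpectrum (𝓞 ↥(maximalRealSubfield L)))
  (w : PlacesOver L v) (hw : IsCMField.complexConj L • w.1 = w.1)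
  (eA : Gqs L v ≃ₜ* ↥(unitaryGroupOfForm (galAdicCompletionMap (L := L) (IsCMField.complexConj L) hw) ((StdForm.antidiagonal 3).over (w.1.adicCompletion L))))
  (heA : ∀ g : Gqs L v,
    ((eA g : ↥(unitaryGroupOfForm (galAdicCompletionMap (L := L) (IsCMField.complexConj L) hw) ((StdForm.antidiagonal 3).over (w.1.adicCompletion L)))) :
        GL (Fin 3) (w.1.adicCompletion L)) =
      ((localNonsplitEquiv (IsCMField.complexConj L) (qsForm L) (IsCMField.complexConj_ne_one L) w hw g :
        ↥(unitaryGroupOfForm (galAdicCompletionMap (L := L) (IsCMField.complexConj L) hw) (placeForm (qsForm L) w.1))) : GL (Fin 3) (w.1.adicCompletion L)))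
  {ϖ : w.1.adicCompletion L} (hϖ : Valued.v ϖ = WithZero.exp (-1 : ℤ))
  (g₁ : GL (Fin 3) (w.1.adicCompletion L)) (hg₁ : (g₁ : Matrix (Fin 3) (Fin 3) (w.1.adicCompletion L)) = Matrix.diagonal ![(1 : w.1.adicCompletion L), 1, ϖ])
  (K0 K1 I : Subgroup (Gqs L v))
  (hK0 : K0 = ((glInt 3 (w.1.adicCompletion L)).subgroupOf
    (unitaryGroupOfForm (galAdicCompletionMap (L := L) (IsCMField.complexConj L) hw) ((StdForm.antidiagonal 3).over (w.1.adicCompletion L)))).comap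
      eA.toMulEquiv.toMonoidHom)
  (hK1 : K1 = (((glInt 3 (w.1.adicCompletion L)).map (MulAut.conj g₁).toMonoidHom).subgroupOf
    (unitaryGroupOfForm (galAdicCompletionMap (L := L) (IsCMField.complexConj L) hw) ((StdForm.antidiagonal 3).over (w.1.adicCompletion L)))).comap
      eA.toMulEquiv.toMonoidHom)
  (hI : I = K0 ⊓ K1)

open Classical in
include hw heA hϖ hg₁ hK0 hK1 hI in
set_option maxHeartbeats 4000000 in
set_option synthInstance.maxHeartbeats 400000 in
-- the `SmoothInd` carrier on `U(Φ₃)(L⁺_v)` read against the `Gqs L v`-frame of ★ PairConstants (class of ★ `K2E3KeysThmTwoDepthZeroBranchBConstants.integral_weyl_weyl_eq`); `@`-form: instances explicit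
/-- **`Λ_{w₀} f₁ = ∫_N f₁(w₀ n w₀) dμ = q⁻¹·μ(N₀)`** (`q = N𝔭_v`) at a non-split place RAMIFIED in `L` with `|2|_w = 1`, for the normalised `(I, χ̃)`-type vector `f₁` (`f₁(1) = 1`, `f₁(w₀) = 0`)
of `i(χ₁, 1)` and a Haar `μ` — ★ `integral_toFun_conj_eq` (`hθ` ★ `theta_conj_eq_one`, `hS` ★ `measurableSet_setOf_conj_mem`) + ★∕📤 `measureReal_setOf_conj_mem_eq_ram` (`vol N(𝔭) = q⁻¹ vol N₀`);
the letter `h1wv` of the RAMIFIED end assembly (twin of ★ `integral_weyl_weyl_eq`, whose constant is `q⁻³`). [cite: Casselman1980, §3] [cite: Rogawski1990, §4.9 p. 54; §12.2 p. 173]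
[cite: Keys1984, §7 Theorem (2) (d) p. 126] -/
theorem integral_weyl_weyl_eq_ram
    (χ₁ : (LocalRing L v)ˣ →* ℂˣ) (w₀ : ↥(unitaryGroupOfForm (conjLocal L (IsCMField.complexConj L) v) (cmLocalForm L 3 v))) (hw₀ : Units.val (w₀ : GL (Fin 3) (LocalRing L v)) = cmLocalForm L 3 v)
    [instM : MeasurableSpace ↥(cmBorelTriple L 3 v).N] [instB : BorelSpace ↥(cmBorelTriple L 3 v).N] (μ : Measure ↥(cmBorelTriple L 3 v).N)
    (f₁ : haveI := locallyCompactSpace_cmBorelU L 3 v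
      Representation.SmoothInd (cmBorelTriple L 3 v).P
        (Representation.twist (((Representation.trivial ℂ ↥(torusU (conjLocal L (IsCMField.complexConj L) v) (cmLocalForm L 3 v)) ℂ).twist
          (cmTorusCharPair L v χ₁ 1)).comp (cmBorelTriple L 3 v).proj) (rootDeltaChar (cmBorelTriple L 3 v).P)))
    (heig₁ : ∀ x ∈ I, (haveI := locallyCompactSpace_cmBorelU L 3 v; Representation.smoothIndRep _ _ x f₁) = (if h : IsUnit (((x.val : GL (Fin 3) (LocalRing L v)) : Matrix (Fin 3) (Fin 3) (LocalRing L v)) 0 0) then ((χ₁ h.unit : ℂˣ) : ℂ) else 0) • f₁)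
    (h11 : f₁.toFun 1 = 1) (h1g : f₁.toFun w₀ = 0) [instH : μ.IsHaarMeasure]
    (he : v.asIdeal.ramificationIdx' w.1.asIdeal ≠ 1) (h2w : Valued.v (2 : w.1.adicCompletion L) = 1) :
    ∫ n : ↥(cmBorelTriple L 3 v).N, f₁.toFun (w₀ * (n : ↥(unitaryGroupOfForm (conjLocal L (IsCMField.complexConj L) v) (cmLocalForm L 3 v))) * w₀) ∂μ = (((Ideal.absNorm v.asIdeal : ℝ) : ℂ))⁻¹ * ((μ.real {m : ↥(cmBorelTriple L 3 v).N | (m : ↥(unitaryGroupOfForm (conjLocal L (IsCMField.complexConj L) v) (cmLocalForm L 3 v))) ∈ I} : ℝ) : ℂ) := by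
  haveI := locallyCompactSpace_cmBorelU L 3 v
  have h := @K2E3BranchBCasselmanPairConstants.integral_toFun_conj_eq L _ _ _ v w hw eA heA _ hϖ g₁ hg₁ K0 K1 I hK0 hK1 hI (cmBorelTriple L 3 v) rfl w₀ hw₀ instM μ _
    (fun g : Gqs L v => if h : IsUnit (((g.val : GL (Fin 3) (LocalRing L v)) : Matrix (Fin 3) (Fin 3) (LocalRing L v)) 0 0) then ((χ₁ h.unit : ℂˣ) : ℂ) else 0)
    f₁ heig₁ h11 h1g (fun n _ => K2E3BranchALettersCM.theta_conj_eq_one L v w hw eA heA (cmBorelTriple L 3 v) rfl w₀ hw₀ χ₁ n.2)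
    (@K2E3BranchBHaarFactsN.measurableSet_setOf_conj_mem L _ _ _ v w hw eA g₁ K0 K1 I hK0 hK1 hI (cmBorelTriple L 3 v) w₀ instM instB)
  rw [measureReal_setOf_conj_mem_eq_ram L v w hw eA heA hϖ g₁ hg₁ K0 K1 I hK0 hK1 hI (cmBorelTriple L 3 v) rfl w₀ hw₀ μ
    (instM := instM) (instB := instB) (instH := instH) he h2w] at h
  refine h.trans ?_
  push_cast
  -- the two spellings of `N₀` (`Gqs L v` ∕ `U(Φ₃)(L⁺_v)` coercions) agree definitionally
  rfl

end Frame

end Summit.HodgeConjecture.HodgeConjecture.R90.S1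

end
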